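import Literature.MathematicalPhysics.QuantumFieldTheory.LatticeGaugeProofs
import HarnessLib

/-!
# Route `LangevinControlUV`, crux `FemtoCurvatureTwoPointC` (stmt-QuantumFields-16204), line `birth` —
# the comb-tree gauge on the full torus `(ℤ/L)⁴`

Wave-3 infrastructure for the torus free-energy sandwich (uniform doubling `Z_L(β/2) ≤ e^{A L⁴} Z_L(β)`
⇒ the crux's variance-ceiling stub V): its lower bound fixes the **comb (complete axial) tree gauge**
on the discrete torus `Λ = (ℤ/L)⁴` (vocabulary of `ConstructiveQFTWave0`: `Site 4 L = Fin 4 → ZMod L`,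
`Edge 4 L = Site × Fin 4`, `Site.shift x i = x + eᵢ`, `gaugeTransform g U (x, i) = g x · U(x,i) · g(x+eᵢ)⁻¹`).

* `combEdges L` — the comb tree rooted at `0` with direction priority `0 → 1 → 2 → 3`: the edge `(x, μ)`
  belongs to it iff all HIGHER coordinates of `x` vanish and it is not the wrap edge of its line
  (`(x μ).val + 1 < L`).  It is a spanning tree with `L⁴ − 1` edges; `card_compl_combEdges` counts
  its complement, `3 L⁴ + 1` of the `4 L⁴` edges (fibrewise over the direction, each fibre being a box
  `Fintype.piFinset (combRange L μ)` of cardinality `L^μ (L − 1)`).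
* `combHolonomy U x` — the ordered product of the links of `U` along the comb path `0 → x` (`x₀` steps
  in direction `0` from `0`, then `x₁` steps in direction `1`, then `x₂`, then `x₃`); segment `μ` starts
  at the truncation `combBase x μ = (x₀, …, x_{μ-1}, 0, …, 0)` and is the straight product `pathProd`.
* `gaugeTransform_combHolonomy_of_mem` — gauging by the comb holonomies kills every comb edge:
  for a comb edge `(x, μ)` the comb path to `x + e_μ` is the comb path to `x` followed by the edge
  (no wrap), so `H(x + e_μ) = H(x) U(x, μ)` (`combHolonomy_shift`) and
  `H(x) U(x,μ) H(x + e_μ)⁻¹ = 1`.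
* `combHolonomy_congr` — `H(U, x)` only reads comb edges; `measurable_combHolonomy` — it is a finite
  ordered product of coordinate projections.

Everything is proved from Mathlib and the torus vocabulary; no named facts.
-/

set_option autoImplicit false

noncomputable section

open Literature.MathematicalPhysics.QuantumFieldTheory

namespace Summit.QuantumFields.YangMills.Theorems.FemtoCurvatureTwoPointC.TorusGauge

variable {L : ℕ}

/-! ### The comb tree -/

/-- **Comb-tree edges of the torus `(ℤ/L)⁴`** (root `0`, direction priority `0 → 1 → 2 → 3`), as a `Finset`: the edge
`(x, μ)` is a comb edge iff every HIGHER coordinate of its base point vanishes (`x ν = 0` for `ν > μ`) and it is not the wrap edge of its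
line (`x μ ≠ L − 1`). There are `L⁴ − 1` of them and they form a spanning tree. -/
def combEdges (L : ℕ) [NeZero L] : Finset (Edge 4 L) :=
  Finset.univ.filter fun e => (∀ ν : Fin 4, e.2 < ν → e.1 ν = 0) ∧ (e.1 e.2).val + 1 < L

/-- Membership in the comb tree, unfolded. -/
theorem mem_combEdges [NeZero L] (e : Edge 4 L) :
    e ∈ combEdges L ↔ (∀ ν : Fin 4, e.2 < ν → e.1 ν = 0) ∧ (e.1 e.2).val + 1 < L := by
  simp [combEdges]

/-- Base point of the direction-`μ` segment of the comb path to `x`: the truncation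
`(x₀, …, x_{μ-1}, 0, …, 0)` of `x` (coordinates `< μ` copied, the others `0`). -/
def combBase (x : Site 4 L) (μ : Fin 4) : Site 4 L :=
  fun ν => if ν < μ then x ν else 0

/-- Coordinates below `μ` of the truncation are those of `x`. -/
theorem combBase_apply_of_lt {x : Site 4 L} {μ ν : Fin 4} (h : ν < μ) : combBase x μ ν = x ν :=
  if_pos h

/-- Coordinates from `μ` on of the truncation vanish. -/
theorem combBase_apply_of_le {x : Site 4 L} {μ ν : Fin 4} (h : μ ≤ ν) : combBase x μ ν = 0 :=
  if_neg (not_lt.2 h)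

/-- The step `x ↦ x + e_μ` does not move the coordinates `ν ≠ μ`. -/
theorem shift_apply_of_ne (x : Site 4 L) {μ ν : Fin 4} (h : ν ≠ μ) : x.shift μ ν = x ν := by
  simp [Site.shift, Pi.single_eq_of_ne h]

/-- The step `x ↦ x + e_μ` adds `1` to the coordinate `μ`. -/
theorem shift_apply_self (x : Site 4 L) (μ : Fin 4) : x.shift μ μ = x μ + 1 := by
  simp [Site.shift]

/-- No wrap: if `(x μ).val + 1 < L` the `μ`-coordinate of `x + e_μ` has value `(x μ).val + 1`. -/
theorem val_shift_apply_self {x : Site 4 L} {μ : Fin 4} (hL : (x μ).val + 1 < L) :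
    (x.shift μ μ).val = (x μ).val + 1 := by
  haveI : Fact (1 < L) := ⟨by omega⟩
  rw [shift_apply_self, ZMod.val_add_of_lt (by rwa [ZMod.val_one]), ZMod.val_one]

/-- The truncations below the stepped direction do not see the step. -/
theorem combBase_shift_of_le (x : Site 4 L) {μ ν : Fin 4} (h : ν ≤ μ) :
    combBase (x.shift μ) ν = combBase x ν := by
  funext ρ
  by_cases hρ : ρ < ν
  · rw [combBase_apply_of_lt hρ, combBase_apply_of_lt hρ, shift_apply_of_ne x (lt_of_lt_of_le hρ h).ne]
  · rw [combBase_apply_of_le (not_lt.1 hρ), combBase_apply_of_le (not_lt.1 hρ)]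

/-- For a base point of the comb tree in direction `μ` (all higher coordinates vanish), the
direction-`μ` segment ends exactly at `x`: `combBase x μ + x_μ e_μ = x`. -/
theorem combBase_add_single {x : Site 4 L} {μ : Fin 4} (hx : ∀ ν : Fin 4, μ < ν → x ν = 0) :
    combBase x μ + Pi.single μ (x μ) = x := by
  funext ν
  rcases lt_trichotomy ν μ with h | rfl | h
  · simp [combBase_apply_of_lt h, Pi.single_eq_of_ne h.ne]
  · simp [combBase_apply_of_le le_rfl]
  · simp [combBase_apply_of_le h.le, Pi.single_eq_of_ne h.ne', hx ν h]

variable {G : Type*} [Group G]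

/-! ### Straight segments -/

/-- Ordered product of `n` consecutive links in direction `μ` starting at `base`:
`U(base, μ) · U(base + e_μ, μ) ⋯ U(base + (n−1)e_μ, μ)`. -/
def pathProd [NeZero L] (U : GaugeConfig 4 L G) (base : Site 4 L) (μ : Fin 4) (n : ℕ) : G :=
  ((List.range n).map fun k => U (base + Pi.single μ ((k : ℕ) : ZMod L), μ)).prod

/-- The empty segment. -/
@[simp] theorem pathProd_zero [NeZero L] (U : GaugeConfig 4 L G) (base : Site 4 L) (μ : Fin 4) :
    pathProd U base μ 0 = 1 := by
  simp [pathProd]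

/-- A segment of `n + 1` links is the segment of `n` links followed by the last link. -/
theorem pathProd_succ [NeZero L] (U : GaugeConfig 4 L G) (base : Site 4 L) (μ : Fin 4) (n : ℕ) :
    pathProd U base μ (n + 1) = pathProd U base μ n * U (base + Pi.single μ ((n : ℕ) : ZMod L), μ) := by
  simp [pathProd, List.range_succ]

/-- A segment only reads its own links. -/
theorem pathProd_congr [NeZero L] {U V : GaugeConfig 4 L G} (base : Site 4 L) (μ : Fin 4) (n : ℕ)
    (h : ∀ k : ℕ, k < n →
      U (base + Pi.single μ ((k : ℕ) : ZMod L), μ) = V (base + Pi.single μ ((k : ℕ) : ZMod L), μ)) :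
    pathProd U base μ n = pathProd V base μ n := by
  unfold pathProd
  congr 1
  exact List.map_congr_left fun k hk => h k (List.mem_range.1 hk)

/-- A segment is measurable in the configuration (finite ordered product of coordinates). -/
theorem measurable_pathProd [NeZero L] [MeasurableSpace G] [MeasurableMul₂ G] (base : Site 4 L)
    (μ : Fin 4) (n : ℕ) : Measurable fun U : GaugeConfig 4 L G => pathProd U base μ n := by
  induction n with
  | zero => simpa only [pathProd_zero] using measurable_const
  | succ n ih =>
    simp only [pathProd_succ]
    exact ih.mul (measurable_pi_apply _)

/-! ### The comb holonomy -/

/-- Segment `μ` of the comb path to `x`: `(x μ).val` links in direction `μ` from the truncation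
`combBase x μ`. -/
def combSegment [NeZero L] (U : GaugeConfig 4 L G) (x : Site 4 L) (μ : Fin 4) : G :=
  pathProd U (combBase x μ) μ (x μ).val

/-- **Comb holonomy** `H(U, x)`: the ordered product of the links of `U` along the comb path from the root `0` to `x`
(first `x₀` steps in direction `0`, then `x₁` in direction `1`, then `x₂` in direction `2`, then `x₃` in direction `3`). -/
def combHolonomy [NeZero L] (U : GaugeConfig 4 L G) (x : Site 4 L) : G :=
  combSegment U x 0 * combSegment U x 1 * combSegment U x 2 * combSegment U x 3

/-- Segments below the stepped direction are unchanged. -/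
theorem combSegment_shift_of_lt [NeZero L] (U : GaugeConfig 4 L G) {x : Site 4 L} {μ ν : Fin 4}
    (h : ν < μ) : combSegment U (x.shift μ) ν = combSegment U x ν := by
  rw [combSegment, combSegment, combBase_shift_of_le x h.le, shift_apply_of_ne x h.ne]

/-- **Key identity**: along a comb edge `(x, μ)` the direction-`μ` segment extends by the link. -/
theorem combSegment_shift_self [NeZero L] (U : GaugeConfig 4 L G) {x : Site 4 L} {μ : Fin 4}
    (hx : ∀ ν : Fin 4, μ < ν → x ν = 0) (hL : (x μ).val + 1 < L) :
    combSegment U (x.shift μ) μ = combSegment U x μ * U (x, μ) := by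
  rw [combSegment, combSegment, combBase_shift_of_le x le_rfl, val_shift_apply_self hL, pathProd_succ,
    ZMod.natCast_zmod_val, combBase_add_single hx]

/-- Segments above the direction of a comb edge are empty (the higher coordinates vanish). -/
theorem combSegment_eq_one_of_gt [NeZero L] (U : GaugeConfig 4 L G) {x : Site 4 L} {μ ν : Fin 4}
    (hx : ∀ ν : Fin 4, μ < ν → x ν = 0) (h : μ < ν) : combSegment U x ν = 1 := by
  rw [combSegment, hx ν h, ZMod.val_zero, pathProd_zero]

/-- Segments above the direction of a comb edge are empty, also after the step. -/
theorem combSegment_shift_eq_one_of_gt [NeZero L] (U : GaugeConfig 4 L G) {x : Site 4 L}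
    {μ ν : Fin 4} (hx : ∀ ν : Fin 4, μ < ν → x ν = 0) (h : μ < ν) :
    combSegment U (x.shift μ) ν = 1 := by
  rw [combSegment, shift_apply_of_ne x h.ne', hx ν h, ZMod.val_zero, pathProd_zero]

/-- Four-fold ordered products: if `g` agrees with `f` below `μ`, is `f μ · u` at `μ`, and both are
trivial above `μ`, then `g₀g₁g₂g₃ = f₀f₁f₂f₃ · u`. -/
private theorem prod_four_step {M : Type*} [Monoid M] (f g : Fin 4 → M) (u : M) (μ : Fin 4)
    (hlt : ∀ ν, ν < μ → g ν = f ν) (heq : g μ = f μ * u)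
    (hf : ∀ ν, μ < ν → f ν = 1) (hg : ∀ ν, μ < ν → g ν = 1) :
    g 0 * g 1 * g 2 * g 3 = f 0 * f 1 * f 2 * f 3 * u := by
  obtain ⟨k, hk⟩ := μ
  interval_cases k
  · have e : (⟨0, hk⟩ : Fin 4) = 0 := rfl
    simp only [e] at heq hf hg
    rw [heq, hg 1 (by decide), hg 2 (by decide), hg 3 (by decide), hf 1 (by decide),
      hf 2 (by decide), hf 3 (by decide)]
    simp only [mul_one]
  · have e : (⟨1, hk⟩ : Fin 4) = 1 := rfl
    simp only [e] at hlt heq hf hg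
    rw [hlt 0 (by decide), heq, hg 2 (by decide), hg 3 (by decide), hf 2 (by decide),
      hf 3 (by decide)]
    simp only [mul_one, mul_assoc]
  · have e : (⟨2, hk⟩ : Fin 4) = 2 := rfl
    simp only [e] at hlt heq hf hg
    rw [hlt 0 (by decide), hlt 1 (by decide), heq, hg 3 (by decide), hf 3 (by decide)]
    simp only [mul_one, mul_assoc]
  · have e : (⟨3, hk⟩ : Fin 4) = 3 := rfl
    simp only [e] at hlt heq
    rw [hlt 0 (by decide), hlt 1 (by decide), hlt 2 (by decide), heq]
    simp only [mul_assoc]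

/-- **The comb path to `x + e_μ` is the comb path to `x` followed by the comb edge `(x, μ)`**:
`H(x + e_μ) = H(x) U(x, μ)`. -/
theorem combHolonomy_shift [NeZero L] (U : GaugeConfig 4 L G) {x : Site 4 L} {μ : Fin 4}
    (hx : ∀ ν : Fin 4, μ < ν → x ν = 0) (hL : (x μ).val + 1 < L) :
    combHolonomy U (x.shift μ) = combHolonomy U x * U (x, μ) :=
  prod_four_step (combSegment U x) (combSegment U (x.shift μ)) (U (x, μ)) μ
    (fun _ hν => combSegment_shift_of_lt U hν) (combSegment_shift_self U hx hL)
    (fun _ hν => combSegment_eq_one_of_gt U hx hν) (fun _ hν => combSegment_shift_eq_one_of_gt U hx hν)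

/-- **The comb gauge kills every comb edge**: gauging `U` by its own comb holonomies, `U^H (x, μ) = H(x) U(x,μ) H(x + e_μ)⁻¹ = 1`
for every comb edge, because the comb path to `x + e_μ` is the comb path to `x` followed by the edge `(x, μ)` (no wrap). -/
theorem gaugeTransform_combHolonomy_of_mem :
    ∀ {L : ℕ} [NeZero L] {G : Type*} [Group G] (U : GaugeConfig 4 L G) {e : Edge 4 L},
      e ∈ combEdges L → gaugeTransform (combHolonomy U) U e = 1 := by
  intro L _ G _ U e he
  obtain ⟨x, μ⟩ := e
  rw [mem_combEdges] at he
  simp only [gaugeTransform]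
  rw [combHolonomy_shift U he.1 he.2, mul_inv_cancel]

/-- Every link read by a segment of a comb path is a comb edge. -/
theorem combBase_add_single_mem [NeZero L] (x : Site 4 L) (ν : Fin 4) {k : ℕ} (hk : k < (x ν).val) :
    (combBase x ν + Pi.single ν ((k : ℕ) : ZMod L), ν) ∈ combEdges L := by
  have hkL : k + 1 < L := by have := ZMod.val_lt (x ν); omega
  rw [mem_combEdges]
  refine ⟨fun ρ hρ => ?_, ?_⟩
  · simp [combBase_apply_of_le hρ.le, Pi.single_eq_of_ne hρ.ne']
  · simpa [combBase_apply_of_le le_rfl, ZMod.val_natCast, Nat.mod_eq_of_lt (by omega : k < L)]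
      using hkL

/-- **Comb holonomies depend only on the comb edges.** -/
theorem combHolonomy_congr :
    ∀ {L : ℕ} [NeZero L] {G : Type*} [Group G] {U V : GaugeConfig 4 L G},
      (∀ e ∈ combEdges L, U e = V e) → ∀ x : Site 4 L, combHolonomy U x = combHolonomy V x := by
  intro L _ G _ U V h x
  have hseg : ∀ ν : Fin 4, combSegment U x ν = combSegment V x ν := fun ν =>
    pathProd_congr _ _ _ fun k hk => h _ (combBase_add_single_mem x ν hk)
  simp only [combHolonomy, hseg]

/-- Each comb segment is measurable in the configuration. -/
theorem measurable_combSegment [NeZero L] [MeasurableSpace G] [MeasurableMul₂ G] (x : Site 4 L)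
    (μ : Fin 4) : Measurable fun U : GaugeConfig 4 L G => combSegment U x μ :=
  measurable_pathProd _ _ _

/-- **Comb holonomies are measurable in the configuration** (finite ordered products of coordinates). -/
theorem measurable_combHolonomy :
    ∀ {L : ℕ} [NeZero L] {G : Type*} [Group G] [MeasurableSpace G] [MeasurableMul₂ G] (x : Site 4 L),
      Measurable fun U : GaugeConfig 4 L G => combHolonomy U x := by
  intro L _ G _ _ _ x
  exact (((measurable_combSegment x 0).mul (measurable_combSegment x 1)).mul
    (measurable_combSegment x 2)).mul (measurable_combSegment x 3)

/-! ### Counting the comb edges -/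

/-- Coordinate ranges of the base points of the direction-`μ` comb edges: coordinate `ν` is free below
`μ`, avoids the wrap value `L − 1` at `μ`, and vanishes above `μ`. -/
def combRange (L : ℕ) [NeZero L] (μ ν : Fin 4) : Finset (ZMod L) :=
  if μ < ν then {0} else if ν = μ then Finset.univ.filter (fun a : ZMod L => a.val + 1 < L)
    else Finset.univ

/-- The base points of the direction-`μ` comb edges form the box `∏_ν combRange L μ ν`. -/
theorem mem_piFinset_combRange [NeZero L] (x : Site 4 L) (μ : Fin 4) :
    x ∈ Fintype.piFinset (combRange L μ) ↔ (x, μ) ∈ combEdges L := by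
  rw [Fintype.mem_piFinset, mem_combEdges]
  constructor
  · intro h
    refine ⟨fun ν hν => ?_, ?_⟩
    · simpa [combRange, hν] using h ν
    · simpa [combRange] using h μ
  · rintro ⟨h1, h2⟩ ν
    unfold combRange
    split_ifs with hlt heq
    · simpa using h1 ν hlt
    · subst heq; simpa using h2
    · exact Finset.mem_univ _

/-- The direction-`μ` fibre of the comb tree. -/
theorem combEdges_filter_snd [NeZero L] (μ : Fin 4) :
    (combEdges L).filter (fun e => e.2 = μ) = Fintype.piFinset (combRange L μ) ×ˢ {μ} := by
  ext ⟨x, ν⟩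
  simp only [Finset.mem_filter, Finset.mem_product, Finset.mem_singleton]
  constructor
  · rintro ⟨h, rfl⟩
    exact ⟨(mem_piFinset_combRange x ν).2 h, rfl⟩
  · rintro ⟨h, rfl⟩
    exact ⟨(mem_piFinset_combRange x _).1 h, rfl⟩

/-- All residues but the wrap value `L − 1`: `#{a : ZMod L | a.val + 1 < L} = L − 1`. -/
theorem card_filter_val_succ_lt (L : ℕ) [NeZero L] :
    (Finset.univ.filter fun a : ZMod L => a.val + 1 < L).card = L - 1 := by
  have hL : 0 < L := Nat.pos_of_ne_zero (NeZero.ne L)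
  have h := Finset.card_filter_add_card_filter_not (s := (Finset.univ : Finset (ZMod L)))
    (fun a : ZMod L => a.val + 1 < L)
  have hneg : (Finset.univ.filter fun a : ZMod L => ¬ (a.val + 1 < L)) = {((L - 1 : ℕ) : ZMod L)} := by
    ext a
    simp only [Finset.mem_filter, Finset.mem_univ, true_and, Finset.mem_singleton, not_lt]
    constructor
    · intro ha
      have hlt := ZMod.val_lt a
      have hval : a.val = L - 1 := by omega
      rw [← ZMod.natCast_zmod_val a, hval]
    · rintro rfl
      rw [ZMod.val_cast_of_lt (by omega : L - 1 < L)]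
      omega
  rw [hneg, Finset.card_singleton, Finset.card_univ, ZMod.card] at h
  omega

/-- **The comb tree has `L⁴ − 1` edges** (`L^μ (L − 1)` in direction `μ`). -/
theorem card_combEdges_add_one (L : ℕ) [NeZero L] : (combEdges L).card + 1 = L ^ 4 := by
  classical
  rw [Finset.card_eq_sum_card_fiberwise (f := Prod.snd) (s := combEdges L) (t := Finset.univ)
    (fun e _ => Finset.mem_coe.2 (Finset.mem_univ _))]
  simp only [combEdges_filter_snd, Finset.card_product, Finset.card_singleton, mul_one,
    Fintype.card_piFinset]
  rw [Fin.sum_univ_four, Fin.prod_univ_four, Fin.prod_univ_four, Fin.prod_univ_four, Fin.prod_univ_four]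
  simp only [combRange, card_filter_val_succ_lt, Finset.card_univ, ZMod.card, Finset.card_singleton,
    Fin.isValue, Fin.reduceLT, Fin.reduceEq, if_true, if_false]
  obtain ⟨a, rfl⟩ : ∃ a : ℕ, L = a + 1 := ⟨L - 1, by have := NeZero.ne L; omega⟩
  rw [Nat.add_sub_cancel]
  ring

/-- **Edge count off the comb tree**: `3L⁴ + 1` of the `4L⁴` edges are not comb edges (`L ≥ 1`). -/
theorem card_compl_combEdges : ∀ (L : ℕ) [NeZero L], ((combEdges L)ᶜ).card = 3 * L ^ 4 + 1 := by
  intro L _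
  -- `#E = 4 L⁴` (as in `FemtoCurvatureTwoPoint.DoublingOfRV.card_edge`, recomputed to keep the imports light)
  have hE : Fintype.card (Edge 4 L) = 4 * L ^ 4 := by
    rw [Fintype.card_prod, Fintype.card_fun, ZMod.card, Fintype.card_fin]
    ring
  have h1 := Finset.card_add_card_compl (combEdges L)
  have h2 := card_combEdges_add_one L
  rw [hE] at h1
  generalize L ^ 4 = N at h1 h2
  omega

end Summit.QuantumFields.YangMills.Theorems.FemtoCurvatureTwoPointC.TorusGauge

end
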